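import Mathlib.Analysis.SpecialFunctions.Log.Base
import Literature.InformationTheory.Entropy.MapEntropy
import HarnessLib

/-!
# Route SzkEntropy, crux `PeaThreeNotInP` (stmt-PneNP-10776), line `SketchIdeator3`: the Jensen–Shannon
# accounting lemma (registered stub `stub_jsd`)

Generic entropy bookkeeping for the tensor-isomorphism line (skeleton
`Cruxes/PeaThreeNotInP/Lines/SketchIdeator3.lean`), over `Literature.InformationTheory.Entropy.mapEntropy`
(the Shannon entropy in bits of the image of a uniform distribution): `mixture_entropy_ge` =
**`stub_jsd`** — if two maps `f, g` on the same uniform sample space hit an event `E` with the same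
mass `π` and their `E`-parts have disjoint images, the fair mixture gains at least `π` bits over the
average entropy, `(H f + H g)/2 + π ≤ H(mix f g)` (log-sum inequality termwise on the image; the
`E`-terms contribute exactly `π` on each side).  First proved (same statement) in the ideation sketch
`Cruxes/PeaThreeNotInP/SketchIdeator3.lean`.

Sources: T. Cover, J. Thomas, *Elements of Information Theory*, 2nd ed., §2.6–2.7 (log-sum
inequality, Jensen); the line card `Cruxes/PeaThreeNotInP/Ideas/tensor-iso-monoid-import.md`.
-/

noncomputable section

open Finset
open Literature.InformationTheory.Entropy

namespace Summit.PneNP.PneNP.Cruxes.PeaThreeNotInP.TensorIsoLine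

set_option linter.dupNamespace false -- `Summit.PneNP.PneNP.…`: summit = sub-problem name (D-0017 single-conjunct layout)

/-- Tangent bound `log₂ x ≥ (1 - 1/x) / ln 2` for `x > 0`. [folklore] -/
theorem one_sub_inv_div_log_two_le_logb {x : ℝ} (hx : 0 < x) :
    (1 - x⁻¹) / Real.log 2 ≤ Real.logb 2 x := by
  have hlog2 : 0 < Real.log 2 := Real.log_pos (by norm_num)
  unfold Real.logb
  rw [div_le_div_iff_of_pos_right hlog2]
  have h := Real.log_le_sub_one_of_pos (inv_pos.2 hx)
  rw [Real.log_inv] at h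
  linarith

/-- Termwise nonnegativity `a log₂(2a/(a+b)) + b log₂(2b/(a+b)) ≥ 0` (log-sum inequality, two-point
case), with Lean's junk conventions at `a = 0` or `b = 0`. [folklore] -/
theorem termwise_nonneg {x y : ℝ} (ha : 0 ≤ x) (hb : 0 ≤ y) (hab : 0 < x + y) :
    0 ≤ x * Real.logb 2 (2 * x / (x + y)) + y * Real.logb 2 (2 * y / (x + y)) := by
  have hlog2 : 0 < Real.log 2 := Real.log_pos (by norm_num)
  have key : ∀ {z : ℝ}, 0 ≤ z →
      z * ((1 - (2 * z / (x + y))⁻¹) / Real.log 2) ≤ z * Real.logb 2 (2 * z / (x + y)) := by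
    intro z hc
    rcases hc.lt_or_eq with hc' | h0
    · exact mul_le_mul_of_nonneg_left (one_sub_inv_div_log_two_le_logb (by positivity)) hc'.le
    · subst h0; simp
  have h1 := key ha
  have h2 := key hb
  have hsum : 0 ≤ x * (1 - (2 * x / (x + y))⁻¹) + y * (1 - (2 * y / (x + y))⁻¹) := by
    rcases ha.lt_or_eq with ha' | ha0
    · rcases hb.lt_or_eq with hb' | hb0
      · have : x * (1 - (2 * x / (x + y))⁻¹) + y * (1 - (2 * y / (x + y))⁻¹) = 0 := by
          field_simp
          ring
        rw [this]
      · subst hb0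
        have : (2 * x / (x + 0))⁻¹ = 1 / 2 := by
          rw [add_zero, mul_div_assoc, div_self ha'.ne', mul_one, one_div]
        rw [this]
        norm_num
        linarith
    · subst ha0
      have hb' : 0 < y := by linarith
      have : (2 * y / (0 + y))⁻¹ = 1 / 2 := by
        rw [zero_add, mul_div_assoc, div_self hb'.ne', mul_one, one_div]
      rw [this]
      norm_num
      linarith
  have hsum' : 0 ≤ x * ((1 - (2 * x / (x + y))⁻¹) / Real.log 2) +
      y * ((1 - (2 * y / (x + y))⁻¹) / Real.log 2) := by
    have : x * ((1 - (2 * x / (x + y))⁻¹) / Real.log 2) +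
        y * ((1 - (2 * y / (x + y))⁻¹) / Real.log 2) =
        (x * (1 - (2 * x / (x + y))⁻¹) + y * (1 - (2 * y / (x + y))⁻¹)) / Real.log 2 := by
      ring
    rw [this]
    exact div_nonneg hsum hlog2.le
  linarith

/-- Exact value when the second side vanishes: `a log₂(2a/a) + 0 = a`. [folklore] -/
theorem termwise_eq_left {x : ℝ} (ha : 0 < x) :
    x * Real.logb 2 (2 * x / (x + 0)) + 0 * Real.logb 2 (2 * 0 / (x + 0)) = x := by
  have : 2 * x / (x + 0) = 2 := by
    rw [add_zero, mul_div_assoc, div_self ha.ne', mul_one]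
  rw [this, Real.logb_self_eq_one (by norm_num : (1:ℝ) < 2)]
  ring

/-- Exact value when the first side vanishes. [folklore] -/
theorem termwise_eq_right {y : ℝ} (hb : 0 < y) :
    0 * Real.logb 2 (2 * 0 / (0 + y)) + y * Real.logb 2 (2 * y / (0 + y)) = y := by
  have : 2 * y / (0 + y) = 2 := by
    rw [zero_add, mul_div_assoc, div_self hb.ne', mul_one]
  rw [this, Real.logb_self_eq_one (by norm_num : (1:ℝ) < 2)]
  ring

variable {ι β : Type*} [Fintype ι] [DecidableEq β]

/-- A fibre over `y` is empty iff `y` is not a value. [folklore] -/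
theorem card_fiber_univ_eq_zero_iff (f : ι → β) (y : β) :
    (fiber (univ : Finset ι) f y).card = 0 ↔ y ∉ (univ : Finset ι).image f := by
  rw [Finset.card_eq_zero, Finset.mem_image]
  constructor
  · rintro h ⟨i, -, rfl⟩
    have : i ∈ fiber univ f (f i) := self_mem_fiber f (mem_univ i)
    rw [h] at this
    simp at this
  · intro h
    ext i
    simp only [mem_fiber, mem_univ, true_and, Finset.notMem_empty, iff_false]
    intro hi
    exact h ⟨i, mem_univ i, hi⟩

/-- **The Jensen–Shannon accounting lemma (first lemma (b), proved).** If two maps `f, g` on the same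
uniform sample space hit an event `E` with the same mass `π` and their `E`-parts have disjoint
images, the fair mixture gains at least `π` bits over the average entropy:
`(H f + H g)/2 + π ≤ H(mix)`. [card tensor-iso-monoid-import, First lemma (b)] -/
theorem mixture_entropy_ge [Nonempty ι]
    (f g : ι → β) (E : Set β) [DecidablePred (· ∈ E)] (π : ℝ)
    (hf : ((Finset.univ.filter fun i => f i ∈ E).card : ℝ) = π * Fintype.card ι)
    (hg : ((Finset.univ.filter fun i => g i ∈ E).card : ℝ) = π * Fintype.card ι)
    (hdisj : ∀ i j, f i ∈ E → g j ∈ E → f i ≠ g j) :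
    (mapEntropy Finset.univ f + mapEntropy Finset.univ g) / 2 + π ≤
      mapEntropy (Finset.univ : Finset (Bool × ι)) (fun p => if p.1 then f p.2 else g p.2) := by
  classical
  set m : Bool × ι → β := fun p => if p.1 then f p.2 else g p.2 with hm
  set N : ℝ := (Fintype.card ι : ℝ) with hNdef
  have hN : 0 < N := by
    rw [hNdef]; exact_mod_cast Fintype.card_pos
  set A : β → ℝ := fun y => ((fiber (univ : Finset ι) f y).card : ℝ) with hadef
  set B : β → ℝ := fun y => ((fiber (univ : Finset ι) g y).card : ℝ) with hbdef
  have ha_nn : ∀ y, 0 ≤ A y := fun y => by rw [hadef]; positivity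
  have hb_nn : ∀ y, 0 ≤ B y := fun y => by rw [hbdef]; positivity
  have ha_pos : ∀ i, 0 < A (f i) := fun i => by
    simp only [hadef]; exact_mod_cast card_fiber_pos f (mem_univ i)
  have hb_pos : ∀ j, 0 < B (g j) := fun j => by
    simp only [hbdef]; exact_mod_cast card_fiber_pos g (mem_univ j)
  have ha_zero_iff : ∀ y, A y = 0 ↔ y ∉ univ.image f := fun y => by
    simp only [hadef, Nat.cast_eq_zero]; exact card_fiber_univ_eq_zero_iff f y
  have hb_zero_iff : ∀ y, B y = 0 ↔ y ∉ univ.image g := fun y => by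
    simp only [hbdef, Nat.cast_eq_zero]; exact card_fiber_univ_eq_zero_iff g y
  have hfib : ∀ y, ((fiber (univ : Finset (Bool × ι)) m y).card : ℝ) = A y + B y := by
    intro y
    simp only [hadef, hbdef, fiber, Finset.card_filter, Fintype.sum_prod_type, Fintype.sum_bool,
      hm]
    push_cast
    simp
  have hcard : (((univ : Finset (Bool × ι)).card : ℕ) : ℝ) = 2 * N := by
    rw [Finset.card_univ, Fintype.card_prod, Fintype.card_bool, hNdef]
    push_cast
    ring
  have Hm : mapEntropy (univ : Finset (Bool × ι)) m =
      ((∑ i, Real.logb 2 (2 * N / (A (f i) + B (f i)))) +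
        ∑ i, Real.logb 2 (2 * N / (A (g i) + B (g i)))) / (2 * N) := by
    unfold mapEntropy
    rw [hcard]
    congr 1
    rw [Fintype.sum_prod_type, Fintype.sum_bool]
    congr 1
    · refine Finset.sum_congr rfl fun i _ => ?_
      rw [hfib]
      simp [hm]
    · refine Finset.sum_congr rfl fun i _ => ?_
      rw [hfib]
      simp [hm]
  have Hf : mapEntropy (univ : Finset ι) f = (∑ i, Real.logb 2 (N / A (f i))) / N := by
    simp only [mapEntropy, Finset.card_univ, hNdef, hadef]
  have Hg : mapEntropy (univ : Finset ι) g = (∑ i, Real.logb 2 (N / B (g i))) / N := by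
    simp only [mapEntropy, Finset.card_univ, hNdef, hbdef]
  have hquot : ∀ {p q : ℝ}, 0 < p → 0 ≤ q →
      Real.logb 2 (2 * N / (p + q)) - Real.logb 2 (N / p) = Real.logb 2 (2 * p / (p + q)) := by
    intro p q hc hd
    have hcd : 0 < p + q := by linarith
    rw [← Real.logb_div (by positivity) (by positivity)]
    congr 1
    field_simp
  set u : β → ℝ := fun y => Real.logb 2 (2 * A y / (A y + B y)) with hudef
  set v : β → ℝ := fun y => Real.logb 2 (2 * B y / (A y + B y)) with hvdef
  have hgoal : (∑ i, Real.logb 2 (N / A (f i))) + (∑ i, Real.logb 2 (N / B (g i))) + 2 * N * π ≤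
      (∑ i, Real.logb 2 (2 * N / (A (f i) + B (f i)))) +
        ∑ i, Real.logb 2 (2 * N / (A (g i) + B (g i))) := by
    have hDf : ∑ i, Real.logb 2 (2 * N / (A (f i) + B (f i))) - ∑ i, Real.logb 2 (N / A (f i)) =
        ∑ i, u (f i) := by
      rw [← Finset.sum_sub_distrib]
      refine Finset.sum_congr rfl fun i _ => ?_
      rw [hudef]
      exact hquot (ha_pos i) (hb_nn _)
    have hDg : ∑ i, Real.logb 2 (2 * N / (A (g i) + B (g i))) - ∑ i, Real.logb 2 (N / B (g i)) =
        ∑ i, v (g i) := by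
      rw [← Finset.sum_sub_distrib]
      refine Finset.sum_congr rfl fun i _ => ?_
      have := hquot (hb_pos i) (ha_nn (g i))
      rw [add_comm (B (g i)) (A (g i))] at this
      rw [this]
    set Y : Finset β := univ.image f ∪ univ.image g with hYdef
    have hregf : ∑ i, u (f i) = ∑ y ∈ Y, A y * u y := by
      rw [Finset.sum_comp u f]
      have : ∑ y ∈ univ.image f, (univ.filter fun i => f i = y).card • u y =
          ∑ y ∈ univ.image f, A y * u y := by
        refine Finset.sum_congr rfl fun y _ => ?_
        rw [nsmul_eq_mul, hadef]
        rfl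
      rw [this]
      refine Finset.sum_subset Finset.subset_union_left fun y _ hy => ?_
      rw [(ha_zero_iff y).2 hy, zero_mul]
    have hregg : ∑ i, v (g i) = ∑ y ∈ Y, B y * v y := by
      rw [Finset.sum_comp v g]
      have : ∑ y ∈ univ.image g, (univ.filter fun i => g i = y).card • v y =
          ∑ y ∈ univ.image g, B y * v y := by
        refine Finset.sum_congr rfl fun y _ => ?_
        rw [nsmul_eq_mul, hbdef]
        rfl
      rw [this]
      refine Finset.sum_subset Finset.subset_union_right fun y _ hy => ?_
      rw [(hb_zero_iff y).2 hy, zero_mul]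
    have hYpos : ∀ y ∈ Y, 0 < A y + B y := by
      intro y hy
      rw [hYdef, Finset.mem_union] at hy
      rcases hy with hy | hy
      · have h1 : A y ≠ 0 := fun h => (ha_zero_iff y).1 h hy
        have h2 := ha_nn y
        have h3 := hb_nn y
        have h4 : 0 < A y := lt_of_le_of_ne h2 (Ne.symm h1)
        linarith
      · have h1 : B y ≠ 0 := fun h => (hb_zero_iff y).1 h hy
        have h2 := ha_nn y
        have h3 := hb_nn y
        have h4 : 0 < B y := lt_of_le_of_ne h3 (Ne.symm h1)
        linarith
    have hterm_nn : ∀ y ∈ Y, 0 ≤ A y * u y + B y * v y := fun y hy =>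
      termwise_nonneg (ha_nn y) (hb_nn y) (hYpos y hy)
    have hterm_E : ∀ y ∈ Y, y ∈ E → A y * u y + B y * v y = A y + B y := by
      intro y hy hyE
      by_cases hay : A y = 0
      · have hby : 0 < B y := by have := hYpos y hy; rw [hay, zero_add] at this; exact this
        have key := termwise_eq_right hby
        rw [hudef, hvdef]
        simp only [hay, zero_add] at key ⊢
        simpa using key
      · by_cases hby : B y = 0
        · have hay' : 0 < A y := lt_of_le_of_ne (ha_nn y) (Ne.symm hay)
          have key := termwise_eq_left hay'
          rw [hudef, hvdef]
          simp only [hby, add_zero] at key ⊢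
          simpa using key
        · exfalso
          have hfa : y ∈ univ.image f := by
            by_contra h
            exact hay ((ha_zero_iff y).2 h)
          have hgb : y ∈ univ.image g := by
            by_contra h
            exact hby ((hb_zero_iff y).2 h)
          obtain ⟨i, -, hi⟩ := Finset.mem_image.1 hfa
          obtain ⟨j, -, hj⟩ := Finset.mem_image.1 hgb
          exact hdisj i j (hi ▸ hyE) (hj ▸ hyE) (hi.trans hj.symm)
    have hsumY : ∑ y ∈ Y.filter (· ∈ E), (A y + B y) ≤ ∑ y ∈ Y, (A y * u y + B y * v y) := by
      rw [← Finset.sum_filter_add_sum_filter_not Y (· ∈ E)]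
      have h1 : ∑ y ∈ Y.filter (· ∈ E), (A y * u y + B y * v y) =
          ∑ y ∈ Y.filter (· ∈ E), (A y + B y) := by
        refine Finset.sum_congr rfl fun y hy => ?_
        rw [Finset.mem_filter] at hy
        exact hterm_E y hy.1 hy.2
      have h2 : 0 ≤ ∑ y ∈ Y.filter (fun y => ¬ y ∈ E), (A y * u y + B y * v y) :=
        Finset.sum_nonneg fun y hy => hterm_nn y (Finset.mem_filter.1 hy).1
      linarith
    have hEa : ∑ y ∈ Y.filter (· ∈ E), A y = π * N := by
      rw [← hf]
      have hmaps : ∀ i ∈ univ.filter (fun i => f i ∈ E), f i ∈ Y.filter (· ∈ E) := by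
        intro i hi
        rw [Finset.mem_filter] at hi ⊢
        exact ⟨by rw [hYdef]; exact Finset.mem_union_left _ (Finset.mem_image_of_mem f (mem_univ i)), hi.2⟩
      rw [Finset.card_eq_sum_card_fiberwise hmaps]
      push_cast
      refine Finset.sum_congr rfl fun y hy => ?_
      rw [Finset.mem_filter] at hy
      have hset : ((univ.filter fun i => f i ∈ E).filter fun i => f i = y) = fiber univ f y := by
        rw [Finset.filter_filter]
        unfold fiber
        refine Finset.filter_congr fun i _ => ?_
        exact ⟨fun h => h.2, fun h => ⟨by rw [h]; exact hy.2, h⟩⟩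
      rw [hset]
    have hEb : ∑ y ∈ Y.filter (· ∈ E), B y = π * N := by
      rw [← hg]
      have hmaps : ∀ j ∈ univ.filter (fun j => g j ∈ E), g j ∈ Y.filter (· ∈ E) := by
        intro j hj
        rw [Finset.mem_filter] at hj ⊢
        exact ⟨by rw [hYdef]; exact Finset.mem_union_right _ (Finset.mem_image_of_mem g (mem_univ j)), hj.2⟩
      rw [Finset.card_eq_sum_card_fiberwise hmaps]
      push_cast
      refine Finset.sum_congr rfl fun y hy => ?_
      rw [Finset.mem_filter] at hy
      have hset : ((univ.filter fun j => g j ∈ E).filter fun j => g j = y) = fiber univ g y := by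
        rw [Finset.filter_filter]
        unfold fiber
        refine Finset.filter_congr fun j _ => ?_
        exact ⟨fun h => h.2, fun h => ⟨by rw [h]; exact hy.2, h⟩⟩
      rw [hset]
    have hsumE : ∑ y ∈ Y.filter (· ∈ E), (A y + B y) = 2 * N * π := by
      rw [Finset.sum_add_distrib, hEa, hEb]; ring
    have hD : 2 * N * π ≤ ∑ i, u (f i) + ∑ i, v (g i) := by
      rw [hregf, hregg, ← Finset.sum_add_distrib, ← hsumE]
      exact hsumY
    linarith [hDf, hDg, hD]
  rw [Hm, Hf, Hg]
  have hL : ((∑ i, Real.logb 2 (N / A (f i))) / N + (∑ i, Real.logb 2 (N / B (g i))) / N) / 2 + π =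
      ((∑ i, Real.logb 2 (N / A (f i))) + (∑ i, Real.logb 2 (N / B (g i))) + 2 * N * π) / (2 * N) := by
    field_simp
  rw [hL]
  exact div_le_div_of_nonneg_right hgoal (by positivity)

/-- **stub_jsd** (registered stub of the line, = `mixture_entropy_ge` at `Type`): the Jensen–Shannon
accounting lemma. [card tensor-iso-monoid-import, First lemma (b)] -/
theorem stub_jsd {ι β : Type} [Fintype ι] [DecidableEq β] [Nonempty ι]
    (f g : ι → β) (E : Set β) [DecidablePred (· ∈ E)] (π : ℝ)
    (hf : ((Finset.univ.filter fun i => f i ∈ E).card : ℝ) = π * Fintype.card ι)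
    (hg : ((Finset.univ.filter fun i => g i ∈ E).card : ℝ) = π * Fintype.card ι)
    (hdisj : ∀ i j, f i ∈ E → g j ∈ E → f i ≠ g j) :
    (mapEntropy Finset.univ f + mapEntropy Finset.univ g) / 2 + π ≤
      mapEntropy (Finset.univ : Finset (Bool × ι)) (fun p => if p.1 then f p.2 else g p.2) :=
  mixture_entropy_ge f g E π hf hg hdisj

end Summit.PneNP.PneNP.Cruxes.PeaThreeNotInP.TensorIsoLine

end
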